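import Summits.QuantumFields.YangMills.Theorems.LuscherReductionTwistedTraceScalingShellAssembly
import Summits.QuantumFields.YangMills.Theorems.LuscherReductionTwistedTraceScalingBOAssemblyBricks
import Summits.QuantumFields.YangMills.Theorems.LuscherReductionTwistedTraceScalingBOStiffSlowTop
import HarnessLib

/-!
# (COARSE-LOWER, step (a), part 1) THE ABSOLUTE SUP BOUND ON THE CORE: `T(f) ≤ e^{ελ_b}·σμ₀·‖f‖²_{N/χ}` on the soft tube, and `⟨G,K_βG⟩ ≤ e^{ελ_b}·σμ₀·‖G‖²` for gauge-invariant `G` near ONE orbit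
# (lane A of S-BASE, crux `TwistedTraceScaling` stmt-QuantumFields-20203, line «twolattice», stub `stub_fixedLatticeTraceLaw`; COARSE-LOWER(L) step (a) `lambda0_le_record`
# of `pub/ym-fleet/ym-luscher-20007-p1/HANDOFF-g23.md` §NEXT SEAT; director-ym word 2026-08-30T04:01Z «w1 TAKE (a)»; hand A `…-w1` g2)

The `k = 0` SLOW clause of a Born–Oppenheimer brick list, in ABSOLUTE currency (cdisprove UPDATE 32 (iv): COARSE-LOWER's `k = 0` content is the absolute ceiling `λ₀ ≤ e^{εΛ/L}·Λ_BO`,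
not obtainable from relative texts).  For a brick list `K : BOBricks L χ δ` (✓`…BOAssemblyBricks`; the record's is ✓`boBricks_record`):
* ★★ `softTubeSup_of_boBricks K` — `∀ ε > 0, ∃ β0, ∀ β ≥ β0`, every bounded measurable `f` supported in `supp χ_β ∩ {orbitDist < δ β}` has
  `T_β(f) ≤ e^{ελ_b(L³β)}·(K.σ β·μ₀(L³β))·‖f‖²_{N/χ}`.  Proof = the lead's fixed-`β` sup-version Feshbach split ✓`shell_gain_fixed` (✓`…ShellAssemblyFixed`) WITHOUT a gain
  (`g = 0`, `t = 0`: the one-site input is the Perron–Frobenius bound ✓`PhysL2.qform_le_levelValue_zero_mul_l2_of_bdd` at `L = 1`, `B = L³β`), giving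
  `T(f) ≤ σμ₀(1 + 6κ + 2b²/θ₀)‖f‖²`, and the record smallness `κ, b² = o(λ_b)` (`K.hκ_small`, `K.hb_small`).
* ★★ `innerSup_of_boBricks K (hadm : SoftTubeAdmissible L δ χ)` — the same in level currency for GAUGE-INVARIANT bounded measurable `G` supported in `{orbitDist < δ β}`:
  `⟨G, K_β G⟩ ≤ e^{ελ_b}·(K.σ β·μ₀)·‖G‖²` (slice reduction ✓`qform_eq_integral_avgKernel`, ✓`l2_eq_sliceFn_left`, as in ✓`shellGainOneOrbitAt_of_shellBricks`).
Part 2 (`…Lambda0Ceiling`): eight copies + the refined onion at `k = 0` + ✓`valleyGain_record` + the `k = 0` door ⇒ `lambda0_le_record`.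
HONEST FRAMING: a fixed-lattice sup bound near the trivial orbit for a stub of a child of the CONDITIONAL route R2b1 (Lüscher two-lattice reduction); COARSE-LOWER(L), COARSE-TAIL(L),
the stubs and the crux stay OPEN; not infinite volume, not a mass gap, not Clay.  No definitions, no `sorry`.
-/

set_option autoImplicit false

noncomputable section

open MeasureTheory Filter Topology Real
open scoped BigOperators
open Literature.MathematicalPhysics.QuantumFieldTheory
open Literature.MathematicalPhysics.QuantumLattice

namespace Summit.QuantumFields.YangMills.Theorems.FemtoTransferGap.TwoLattice.ConstTube

open Summit.QuantumFields.YangMills.Theorems.FemtoTransferGap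
open Summit.QuantumFields.YangMills.Theorems.FemtoTransferGap.TwoLattice.Avg
open Summit.QuantumFields.YangMills.Theorems.FemtoTransferGap.TwoLattice.Stiff (LinkSpace)

variable {L : ℕ} [NeZero L]

/-! ## §1 ★★ The sup bound on the soft tube (no gain), eventually -/

set_option maxHeartbeats 400000 in
/-- ★★ **THE ABSOLUTE SUP BOUND ON THE SOFT TUBE**: from `K : BOBricks L χ δ`, for every `ε > 0`, eventually in `β`, every bounded measurable `f` supported in `supp χ_β ∩ {orbitDist < δ β}`
has `T_β(f) ≤ e^{ε·λ_b(L³β)}·(K.σ β·μ₀(L³β))·‖f‖²_{N/χ}`. [cite: Luscher1983, §3] [cite: SjostrandZworski2007, §2] -/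
theorem softTubeSup_of_boBricks {χ : ℝ → GaugeConfig 3 L SU2 → ℝ} {δ : ℝ → ℝ} (K : BOBricks L χ δ) {ε : ℝ} (hε : 0 < ε) :
    ∃ β0 : ℝ, ∀ β : ℝ, β0 ≤ β → ∀ f : GaugeConfig 3 L SU2 → ℝ, Measurable f → (∃ C : ℝ, ∀ U, |f U| ≤ C) →
      (∀ U, f U ≠ 0 → χ β U ≠ 0 ∧ orbitDist U < δ β) →
        tubeForm β f ≤ Real.exp (ε * bareLambda ((L : ℝ) ^ 3 * β)) * (K.σ β * levelValue su2Rep 1 ((L : ℝ) ^ 3 * β) 0) * tubeNormSq (softWeight (χ β)) f := by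
  have hL1 : (1 : ℝ) ≤ (L : ℝ) ^ 3 := one_le_pow₀ (by exact_mod_cast NeZero.one_le)
  obtain ⟨hθ0, hθ1⟩ := K.hθ₀
  have hεκ : 0 < ε / 12 := by positivity
  have hεb : 0 < ε * K.θ₀ / 4 := by positivity
  have hev : ∀ᶠ β : ℝ in atTop, ∀ f : GaugeConfig 3 L SU2 → ℝ, Measurable f → (∃ C : ℝ, ∀ U, |f U| ≤ C) →
      (∀ U, f U ≠ 0 → χ β U ≠ 0 ∧ orbitDist U < δ β) →
        tubeForm β f ≤ Real.exp (ε * bareLambda ((L : ℝ) ^ 3 * β)) * (K.σ β * levelValue su2Rep 1 ((L : ℝ) ^ 3 * β) 0) * tubeNormSq (softWeight (χ β)) f := by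
    filter_upwards [Filter.eventually_ge_atTop (2 : ℝ), K.hδ₁, K.hshadow, K.hbo, K.hN, K.hT, K.hST, K.hOD, K.hκ_small (ε / 12) hεκ, K.hb_small (ε * K.θ₀ / 4) hεb,
      K.hκ_small (1 / 2) (by norm_num)]
      with β hβ2 hδ₁ hshadow hbo hN hT hST hOD hκs hbs hκh
    intro f hfm hfb hfs
    have hβ1 : 1 ≤ β := by linarith only [hβ2]
    have hβ0 : 0 < β := by linarith only [hβ1]
    have hBβ : β ≤ (L : ℝ) ^ 3 * β := by nlinarith only [hL1, hβ0]
    have hB0 : 0 < ((L : ℝ) ^ 3 * β) := lt_of_lt_of_le hβ0 hBβ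
    have hB2 : 2 ≤ ((L : ℝ) ^ 3 * β) := hβ2.trans hBβ
    have hlam0 : 0 < bareLambda ((L : ℝ) ^ 3 * β) := bareLambda_pos' hB0
    have hlam1 : bareLambda ((L : ℝ) ^ 3 * β) ≤ 1 := (bareLambda_pos_le_one hB2).2
    have hμ0 : 0 < levelValue su2Rep 1 ((L : ℝ) ^ 3 * β) 0 := levelValue_su2Rep_pos (L := 1) hB0 0
    obtain ⟨Cw, hCw⟩ := K.hwb β
    obtain ⟨Cf, hCf⟩ := hfb
    have hκ0 := K.hκ β
    have hκhalf : K.κ β ≤ 1 / 2 := hκh.trans (by nlinarith only [hlam1])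
    -- the one-site input with NO gain: Perron–Frobenius at `L = 1`, `B = L³β`
    have hAG : ∀ G : GaugeConfig 3 1 SU2 → ℝ, Measurable G → (∃ C : ℝ, ∀ u, |G u| ≤ C) →
        (∀ (g' : Site 3 1 → SU2) (u : GaugeConfig 3 1 SU2), G (gaugeTransform g' u) = G u) → (∀ u, G u ≠ 0 → 6 * (0 : ℝ) ≤ orbitDist u ∧ orbitDist u < 2) →
        qform su2Rep ((L : ℝ) ^ 3 * β) G G ≤ (1 - 0) * levelValue su2Rep 1 ((L : ℝ) ^ 3 * β) 0 * l2 G G := fun G hGm hGb _ _ => by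
      obtain ⟨C, hC⟩ := hGb
      rw [sub_zero, one_mul]
      exact PhysL2.qform_le_levelValue_zero_mul_l2_of_bdd ((L : ℝ) ^ 3 * β) hGm hC
    -- (B-T) upper half
    have hTup : ∀ φ : GaugeConfig 3 1 SU2 → ℝ, Measurable φ → (∃ C : ℝ, ∀ u, |φ u| ≤ C) →
        (∀ (g : Site 3 1 → SU2) (u : GaugeConfig 3 1 SU2), φ (gaugeTransform g u) = φ u) → (∀ u, φ u ≠ 0 → u ∈ K.𝒰 β) →
        tubeForm β (boFun L φ (K.Ω β)) ≤ K.σ β * K.γ β * (1 + K.κ β) * qform su2Rep ((L : ℝ) ^ 3 * β) φ φ +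
          K.κ β * K.σ β * K.γ β * levelValue su2Rep 1 ((L : ℝ) ^ 3 * β) 0 * l2 φ φ :=
      fun φ h1 h2 h3 h4 => by have := (abs_le.mp (hT φ h1 h2 h3 h4)).2; linarith only [this]
    -- supports of `f`
    have hfs1 : ∀ U, f U ≠ 0 → χ β U ≠ 0 := fun U h => (hfs U h).1
    have hfsh : ∀ U, f U ≠ 0 → slowMean L U ∈ K.𝒰 β := fun U h => hshadow U (hfs U h).1 (hfs U h).2
    have hφin : ∀ u, boCoeff L (softWeight (χ β)) (K.Ω β) (K.𝒰 β) f u ≠ 0 → 6 * (0 : ℝ) ≤ orbitDist u :=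
      fun u _ => by rw [mul_zero]; exact orbitDist_nonneg u
    -- the fixed-`β` split with `g = 0`, `t = 0`
    have hδ₁2 : K.δ₁ β ≤ 2 := by linarith only [hδ₁]
    have hfix := shell_gain_fixed (hwm := K.hwm β) hCw (K.hw0 β) (K.hwinv β) (K.hΩm β) (K.hΩ1 β) (K.hΩinv β) (K.h𝒰m β) (K.h𝒰inv β) (K.h𝒰δ₁ β) hδ₁2
      (K.hσ β).le (K.hγ β) hκ0 hκhalf hN hTup (le_refl (0 : ℝ)) zero_le_one hAG hμ0.le hθ0 hST hOD (fun φ U hφ hU => (hbo φ U hφ hU).1) hfm hCf hfs1 hfsh hφin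
    -- endgame: `1 − min(0 − 6κ − 2b²/θ₀, θ₀/2) = 1 + 6κ + 2b²/θ₀ ≤ 1 + ελ_b ≤ e^{ελ_b}`
    set m : ℝ := min (0 - 6 * K.κ β - 2 * K.b β ^ 2 / K.θ₀) (K.θ₀ / 2) with hmdef
    have hb2 : 0 ≤ 2 * K.b β ^ 2 / K.θ₀ := by have := K.hb β; positivity
    have hmeq : m = 0 - 6 * K.κ β - 2 * K.b β ^ 2 / K.θ₀ := by
      rw [hmdef]; exact min_eq_left (by linarith only [hκ0, hb2, hθ0])
    have hrate : 6 * K.κ β + 2 * K.b β ^ 2 / K.θ₀ ≤ ε * bareLambda ((L : ℝ) ^ 3 * β) := by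
      have h1 : 6 * K.κ β ≤ ε / 2 * bareLambda ((L : ℝ) ^ 3 * β) := by linarith only [hκs]
      have h2 : 2 * K.b β ^ 2 / K.θ₀ ≤ ε / 2 * bareLambda ((L : ℝ) ^ 3 * β) := by
        rw [div_le_iff₀ hθ0]
        have : 2 * K.b β ^ 2 ≤ 2 * (ε * K.θ₀ / 4 * bareLambda ((L : ℝ) ^ 3 * β)) := by linarith only [hbs]
        linarith only [this]
      linarith only [h1, h2]
    have h1 : 1 - m ≤ Real.exp (ε * bareLambda ((L : ℝ) ^ 3 * β)) := by
      have := Real.add_one_le_exp (ε * bareLambda ((L : ℝ) ^ 3 * β))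
      rw [hmeq]; linarith only [this, hrate]
    have hN0 : 0 ≤ tubeNormSq (softWeight (χ β)) f := integral_nonneg fun U => mul_nonneg (sq_nonneg _) (K.hw0 β U)
    have hSg0 : 0 ≤ K.σ β * levelValue su2Rep 1 ((L : ℝ) ^ 3 * β) 0 := mul_nonneg (K.hσ β).le hμ0.le
    calc tubeForm β f ≤ K.σ β * levelValue su2Rep 1 ((L : ℝ) ^ 3 * β) 0 * (1 - m) * tubeNormSq (softWeight (χ β)) f := hfix
      _ ≤ K.σ β * levelValue su2Rep 1 ((L : ℝ) ^ 3 * β) 0 * Real.exp (ε * bareLambda ((L : ℝ) ^ 3 * β)) * tubeNormSq (softWeight (χ β)) f :=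
          mul_le_mul_of_nonneg_right (mul_le_mul_of_nonneg_left h1 hSg0) hN0
      _ = Real.exp (ε * bareLambda ((L : ℝ) ^ 3 * β)) * (K.σ β * levelValue su2Rep 1 ((L : ℝ) ^ 3 * β) 0) * tubeNormSq (softWeight (χ β)) f := by ring
  obtain ⟨β₀, hβ₀⟩ := Filter.eventually_atTop.mp hev
  exact ⟨β₀, fun β hβ => hβ₀ β hβ⟩

/-! ## §2 ★★ The same in level currency, for gauge-invariant functions near ONE orbit -/

/-- ★★ **THE ABSOLUTE SUP BOUND NEAR ONE ORBIT**: from `K : BOBricks L χ δ` with `χ` admissible at radius `δ`, for every `ε > 0`, eventually in `β`, every GAUGE-INVARIANT bounded measurable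
`G` supported in `{orbitDist < δ β}` has `⟨G, K_β G⟩ ≤ e^{ε·λ_b(L³β)}·(K.σ β·μ₀(L³β))·‖G‖²`. [cite: Luscher1983, §3] [cite: SeilerLNP1982, §3] -/
theorem innerSup_of_boBricks {χ : ℝ → GaugeConfig 3 L SU2 → ℝ} {δ : ℝ → ℝ} (K : BOBricks L χ δ) (hadm : SoftTubeAdmissible L δ χ) {ε : ℝ} (hε : 0 < ε) :
    ∃ β0 : ℝ, ∀ β : ℝ, β0 ≤ β → ∀ G : GaugeConfig 3 L SU2 → ℝ, Measurable G → (∃ C : ℝ, ∀ U, |G U| ≤ C) →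
      (∀ (g : Site 3 L → SU2) (U : GaugeConfig 3 L SU2), G (gaugeTransform g U) = G U) → (∀ U, G U ≠ 0 → orbitDist U < δ β) →
        qform su2Rep β G G ≤ Real.exp (ε * bareLambda ((L : ℝ) ^ 3 * β)) * (K.σ β * levelValue su2Rep 1 ((L : ℝ) ^ 3 * β) 0) * l2 G G := by
  obtain ⟨hχm, hχb, β1, hβ1⟩ := hadm
  obtain ⟨β0, hβ0⟩ := softTubeSup_of_boBricks K hε
  refine ⟨max β0 β1, fun β hβ G hGm hGb hGinv hGsupp => ?_⟩
  have hβ0' : β0 ≤ β := (le_max_left _ _).trans hβ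
  obtain ⟨hcov, n₀, hn₀, hNlow⟩ := hβ1 β ((le_max_right _ _).trans hβ)
  obtain ⟨Cχ, hCχ⟩ := hχb β
  obtain ⟨CG, hCG⟩ := hGb
  have hGcov : ∀ U, G U ≠ 0 → gaugeAvg (χ β) U ≠ 0 := fun U hU => (hcov U (hGsupp U hU)).ne'
  set f : GaugeConfig 3 L SU2 → ℝ := Avg.sliceFn (χ β) G with hf_def
  have h1 := qform_eq_integral_avgKernel β (hχm β) hCχ hn₀ hNlow hGm hCG hGinv hGcov hGm hCG hGinv hGcov
  have h2 := l2_eq_sliceFn_left (hχm β) hCχ hn₀ hNlow hGm hCG hGinv hGcov hGm hCG hGinv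
  have hl2 : l2 G G = tubeNormSq (softWeight (χ β)) f := by
    rw [h2]
    unfold l2 tubeNormSq
    refine integral_congr_ae (ae_of_all _ fun U => ?_)
    exact sliceFn_mul_self_eq (ψ := G) hn₀ hNlow U
  have hq : qform su2Rep β G G = tubeForm β f := by rw [h1]; rfl
  have hfm : Measurable f := Avg.measurable_sliceFn (hχm β) hGm
  have hfb : ∃ C : ℝ, ∀ U, |f U| ≤ C := ⟨CG * Cχ / n₀, Avg.abs_sliceFn_le hCχ hCG hn₀ hNlow⟩
  have hfs : ∀ U, f U ≠ 0 → χ β U ≠ 0 ∧ orbitDist U < δ β := fun U hU =>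
    ⟨(Avg.sliceFn_ne_zero hU).1, hGsupp U (Avg.sliceFn_ne_zero hU).2⟩
  rw [hq, hl2]
  exact hβ0 β hβ0' f hfm hfb hfs

end Summit.QuantumFields.YangMills.Theorems.FemtoTransferGap.TwoLattice.ConstTube

end
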